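import Mathlib
import HarnessLib
import Summits.HodgeConjecture.HodgeConjecture.Theorems.FermatCyclesKleinCriticalCorank

/-!
# Fermat cycles — the Klein cubic threefold: the algebraic core of the KEY LEMMA behind "no curve of off-base
# singular points in the `L6′` family" (`ALBANESE.md` §5.11‴(a), unit `pub-hfermat-search-2`, gen-13/14)

HONEST FRAMING: explicit algebraic cycles for specific Hodge classes on Fermat/Delsarte varieties; residual open
instances listed; no claim on general Hodge.  This file formalises NO geometry and NO analysis.  It kernel-checks the
LINEAR-ALGEBRA step of the Key Lemma of `ALBANESE.md` §5.11‴(a) for the affine-linear `5×5` matrix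
`N(a) = J − 5I − 10M_a` of `FermatCyclesKleinCriticalCorank` (`J` = all-ones, `(M_a)ᵢᵢ = (M_a)ᵢ,ᵢ₊₁ = (M_a)ᵢ₊₁,ᵢ = aᵢ`,
`a₀ = −(a₁+a₂+a₃+a₄)`), namely:

* `N_mulVec_one` : `N(a)·𝟙 = −10·b(a)` with `bᵢ = 2aᵢ + aᵢ₋₁`;
* `kernel_shift` : if a vector `v` satisfies the differentiated constraints of a contracted critical curve,
  `(I + 2M_a)v = −ρ·b(a)` and `Σ vᵢ = 0`, then `N(a)·(2v + ρ𝟙) = 0` — the logarithmic velocity, shifted by a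
  multiple of `𝟙`, lies in `ker N(a)`;
* `velocity_of_kernel` : conversely, if `2v + ρ𝟙 = 2c·κ` and `Σ vᵢ = 0` then `5ρ = 2c·Σκ` and
  `10(ρ + 2vᵢ + vᵢ₊₁) = 2c(10κᵢ + 5κᵢ₊₁ − Σκ)`, i.e. the velocity of `Aᵢ = μaᵢ` is `(c/5)·Ξᵢ(A, κ)/Aᵢ` with the
  kernel field `Ξᵢ(A, κ) = Aᵢ(10κᵢ + 5κᵢ₊₁ − Σκ)` of the unit's tangency recursion.

Informal context (cell file `run/shared/lean/pub/pub-hfermat/pub-hfermat-search-2/ALBANESE.md` §5.10–5.11‴, NOT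
asserted here): along an analytic branch `s ↦ (z(s), μ(s))` of a curve of critical points of `φ_ℓ = Πz/ℓ⁵` on the
Klein cubic contracted by the map `Ψ : (z, μ) ↦ [wᵢ/zᵢ]`, normalised by `ℓ(z) ≡ 1`, the quantities `vᵢ = zᵢ′/zᵢ` and
`ρ = μ′/μ` satisfy exactly the two hypotheses of `kernel_shift` (with `a` replaced by `A = μa`); the conclusion, at
a corank-1 point, makes the image curve an integral curve of the kernel line field, which feeds the unit's degree
certificate.  All of that is proved on paper in the cell file; only the identities below are kernel-checked.

References: cell files as above. No literature statement is used.
-/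

namespace Summit.HodgeConjecture.HodgeConjecture.FermatCycles.KernelShift

open Matrix
open Summit.HodgeConjecture.HodgeConjecture.FermatCycles.KleinCriticalCorank (N)

variable {R : Type*} [CommRing R]

/-- `b(a)`: `bᵢ = 2aᵢ + aᵢ₋₁` (indices mod 5) with `a₀ = −(a₁+a₂+a₃+a₄)`. [folklore] -/
def bvec (a₁ a₂ a₃ a₄ : R) : Fin 5 → R :=
  ![2 * (-(a₁ + a₂ + a₃ + a₄)) + a₄, 2 * a₁ + (-(a₁ + a₂ + a₃ + a₄)), 2 * a₂ + a₁, 2 * a₃ + a₂, 2 * a₄ + a₃]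

/-- `M_a v`: `(M_a v)ᵢ = aᵢvᵢ + aᵢvᵢ₊₁ + aᵢ₋₁vᵢ₋₁` (the periodic Jacobi matrix `M_a`, `a₀ = −(a₁+a₂+a₃+a₄)`). [folklore] -/
def Mv (a₁ a₂ a₃ a₄ : R) (v : Fin 5 → R) : Fin 5 → R :=
  ![(-(a₁ + a₂ + a₃ + a₄)) * v 0 + (-(a₁ + a₂ + a₃ + a₄)) * v 1 + a₄ * v 4,
    a₁ * v 1 + a₁ * v 2 + (-(a₁ + a₂ + a₃ + a₄)) * v 0,
    a₂ * v 2 + a₂ * v 3 + a₁ * v 1,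
    a₃ * v 3 + a₃ * v 4 + a₂ * v 2,
    a₄ * v 4 + a₄ * v 0 + a₃ * v 3]

/-- `N(a) = J − 5I − 10M_a` entrywise on vectors: `(N v)ᵢ = Σⱼvⱼ − 5vᵢ − 10(M_a v)ᵢ`. [folklore] -/
theorem N_mulVec (a₁ a₂ a₃ a₄ : R) (v : Fin 5 → R) :
    (N a₁ a₂ a₃ a₄).mulVec v = fun i => (∑ j, v j) - 5 * v i - 10 * Mv a₁ a₂ a₃ a₄ v i := by
  ext i
  fin_cases i <;> simp [N, Mv, Matrix.mulVec, dotProduct, Fin.sum_univ_five] <;> ring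

/-- `N(a)·𝟙 = −10·b(a)`. [folklore] -/
theorem N_mulVec_one (a₁ a₂ a₃ a₄ : R) :
    (N a₁ a₂ a₃ a₄).mulVec (fun _ => 1) = fun i => -10 * bvec a₁ a₂ a₃ a₄ i := by
  ext i
  fin_cases i <;> simp [N, bvec, Matrix.mulVec, dotProduct, Fin.sum_univ_five] <;> ring

/-- `N(a)·(2v + ρ𝟙) = 2Σv·𝟙 − 10·((I + 2M_a)v + ρ b(a))` entrywise. [folklore] -/
theorem N_mulVec_shift (a₁ a₂ a₃ a₄ ρ : R) (v : Fin 5 → R) :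
    (N a₁ a₂ a₃ a₄).mulVec (fun i => 2 * v i + ρ)
      = fun i => 2 * (∑ j, v j) - 10 * (v i + 2 * Mv a₁ a₂ a₃ a₄ v i + ρ * bvec a₁ a₂ a₃ a₄ i) := by
  ext i
  fin_cases i <;> simp [N, Mv, bvec, Matrix.mulVec, dotProduct, Fin.sum_univ_five] <;> ring

/-- KEY LEMMA, algebraic core (`ALBANESE.md` §5.11‴(a)): the differentiated constraints `(I + 2M_a)v = −ρ·b(a)` and
`Σvᵢ = 0` force `N(a)·(2v + ρ𝟙) = 0`. [folklore] -/
theorem kernel_shift (a₁ a₂ a₃ a₄ ρ : R) (v : Fin 5 → R)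
    (hlin : ∀ i, v i + 2 * Mv a₁ a₂ a₃ a₄ v i = -(ρ * bvec a₁ a₂ a₃ a₄ i))
    (hsum : ∑ j, v j = 0) :
    (N a₁ a₂ a₃ a₄).mulVec (fun i => 2 * v i + ρ) = 0 := by
  rw [N_mulVec_shift]
  ext i
  simp only [Pi.zero_apply]
  linear_combination 2 * hsum - 10 * hlin i

/-- Converse bookkeeping at a corank-1 point: if `2v + ρ𝟙 = 2c·κ` (i.e. `v = cκ − (ρ/2)𝟙`) and `Σvᵢ = 0`, then
`5ρ = 2c·Σκ`. [folklore] -/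
theorem rho_of_kernel (ρ c : R) (v κ : Fin 5 → R)
    (hv : ∀ i, 2 * v i + ρ = 2 * c * κ i) (hsum : ∑ j, v j = 0) :
    5 * ρ = 2 * c * ∑ j, κ j := by
  simp only [Fin.sum_univ_five] at hsum ⊢
  linear_combination hv 0 + hv 1 + hv 2 + hv 3 + hv 4 - 2 * hsum

/-- … and then the logarithmic velocity of `Aᵢ = μaᵢ`, namely `ρ + 2vᵢ + vᵢ₊₁`, equals `(c/5)(10κᵢ + 5κᵢ₊₁ − Σκ)`
(stated free of denominators): the image curve moves along the kernel field `Ξ(A, κ)`. [folklore] -/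
theorem velocity_of_kernel (ρ c : R) (v κ : Fin 5 → R)
    (hv : ∀ i, 2 * v i + ρ = 2 * c * κ i) (hsum : ∑ j, v j = 0) (i : Fin 5) :
    10 * (ρ + 2 * v i + v (i + 1)) = 2 * c * (10 * κ i + 5 * κ (i + 1) - ∑ j, κ j) := by
  have h5 := rho_of_kernel ρ c v κ hv hsum
  linear_combination 10 * hv i + 5 * hv (i + 1) - h5

end Summit.HodgeConjecture.HodgeConjecture.FermatCycles.KernelShift
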